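import Mathlib.RingTheory.PowerSeries.Basic
import Mathlib.Analysis.Normed.Ring.Basic
import HarnessLib

/-!
# The `λ`-invariant of a power series read off its coefficient norms (definitions)

Topic `Literature/NumberTheory/EllipticCurves`, namespace `Literature.NumberTheory.EllipticCurves`.

For a power series `F = ∑ aₙ Tⁿ` over a (semi)normed ring `R` — in the applications `R = ℤ_p`,
`ℚ_p`, the ring of integers `𝒪` of a finite extension `L/ℚ_p`, `L` itself, or `ℚ̄_p` — we define

* `IsMaxCoeffAt F n`: the coefficient `aₙ` has maximal norm, `‖aₘ‖ ≤ ‖aₙ‖` for all `m`;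
* `HasMaxCoeff F`: some coefficient has maximal norm (automatic for `F ≠ 0` bounded with
  coefficients in a discretely valued field, e.g. `0 ≠ F ∈ Λ_𝒪 = 𝒪⟦T⟧`; it fails e.g. for
  `∑ p^{1/n} Tⁿ` over `ℂ_p`);
* `normLam F : ℕ` — **the `λ`-invariant**: the least index of a coefficient of maximal norm
  (junk value `0` when no coefficient has maximal norm).

For `F ∈ Λ_𝒪 = 𝒪⟦T⟧` with `μ(F) = 0` (some coefficient a unit), `normLam F` is the least `n`
with `aₙ ∈ 𝒪^×`, i.e. the Weierstrass degree `λ(F)` — the degree of the distinguished polynomial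
of `F` (Washington, *Introduction to Cyclotomic Fields*, §7.1: Prop. 7.2 and the `p`-adic
Weierstrass preparation theorem, Thm. 7.3, "`f = ∑ aᵢTⁱ` with `aᵢ ∈ 𝔭` for `i < n`, `aₙ ∈ 𝒪^×`
… `f = P·U` with `P` distinguished of degree `n`"; Greenberg–Vatsal (1): `λ = deg f(T)`), "the
number of zeroes" in Emerton–Pollack–Weston's definition of `λ^alg`, `λ^an` (§3.1: the number of
zeroes of the characteristic power series, resp. of the `p`-adic `L`-function). In general
`normLam F = λ(π^{-μ(F)} F)` is the `λ`-invariant of the normalised series; it is insensitive to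
scaling by a constant of non-zero norm, so the `λ`-invariant of the `p`-adic `L`-function of a
newform does not depend on the period, and that of a characteristic power series not on the
generator.

This file is vocabulary item (V-inv) of the BSD residual cell's GL₂ request
(run/shared/lean/b2b/bsd-rank1-residual/b2b-bsdres-x11a/GL2-VOCAB-SPEC.md): the common currency in
which the `λ`-invariants of an elliptic curve (`ℤ_p`-coefficients) and of a higher-weight member of
its Hida family (`𝒪`-coefficients) are compared (Emerton–Pollack–Weston 2006, Thm. 2; X. Wan 2015,
Thm. 4). DEFINITIONS ONLY (three, each carrying the citation of the notion it formalises); the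
API (transport by norm-preserving maps, scaling invariance, `λ(T·F) = λ(F) + 1`, and over `ℤ_p`:
`normLam F = ord_T (F mod p)` for unit content = the cell's `X1.MuLambda.lam`, additivity) is
proved in `Summits/BirchSwinnertonDyer/Rank1Residual/X11a/LambdaNorm.lean`.

References: L. Washington, *Introduction to Cyclotomic Fields*, GTM 83, §7.1 (Prop. 7.2,
Thm. 7.3), §13.3; R. Greenberg, V. Vatsal, *On the Iwasawa invariants of elliptic curves*, Invent.
Math. 142 (2000), p. 2, (1)–(2); M. Emerton, R. Pollack, T. Weston, *Variation of Iwasawa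
invariants in Hida families*, Invent. Math. 163 (2006), §3.1.
-/

noncomputable section

namespace Literature.NumberTheory.EllipticCurves

variable {R : Type*} [SeminormedRing R]

/-- `IsMaxCoeffAt F n`: the `n`-th coefficient of the power series `F` has maximal norm among all
coefficients, `‖aₘ‖ ≤ ‖aₙ‖` for every `m`. For `F ∈ 𝒪⟦T⟧` with a unit coefficient these are
exactly the indices of the unit coefficients (Washington §7.1, the indices `n` with `aₙ ∈ 𝒪^×` in
Prop. 7.2 / Thm. 7.3). [cite: Washington1997, §7.1 (Prop. 7.2, Thm. 7.3)] -/
def IsMaxCoeffAt (F : PowerSeries R) (n : ℕ) : Prop :=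
  ∀ m : ℕ, ‖PowerSeries.coeff m F‖ ≤ ‖PowerSeries.coeff n F‖

/-- `HasMaxCoeff F`: some coefficient of `F` has maximal norm (the supremum of the coefficient
norms is attained) — e.g. every non-zero bounded `F` over a discretely valued field, in particular
every non-zero `F ∈ Λ_𝒪 = 𝒪⟦T⟧` (Washington §7.1: a non-zero `f ∈ 𝒪⟦T⟧` is `π^μ` times a series
with a unit coefficient). [cite: Washington1997, §7.1 (Lemma 7.5 / Thm. 7.3)] -/
def HasMaxCoeff (F : PowerSeries R) : Prop :=
  ∃ n : ℕ, IsMaxCoeffAt F n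

/-- **The `λ`-invariant of a power series with valued coefficients**: the least index of a
coefficient of maximal norm (junk `0` if the maximum is not attained). For `F ∈ 𝒪⟦T⟧` with
`μ(F) = 0` this is the least `n` with `aₙ` a unit, i.e. the Weierstrass degree `λ(F)` = the degree
of the distinguished polynomial of `F` = the number of zeroes of `F` in the open unit disc
(Washington §7.1, Prop. 7.2 and Thm. 7.3; Greenberg–Vatsal (1): `λ = deg f(T)`;
Emerton–Pollack–Weston §3.1: `λ^alg`, `λ^an` = "the number of zeroes"); in general it is `λ` of
the normalised series `π^{-μ(F)} F`, invariant under scaling by a constant of non-zero norm.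
[cite: Washington1997, §7.1 (Prop. 7.2, Thm. 7.3)] [cite: GreenbergVatsal2000, p. 2, (1)–(2)]
[cite: EmertonPollackWeston2006, §3.1 (definition of λ^alg, λ^an)] -/
def normLam (F : PowerSeries R) : ℕ :=
  sInf {n : ℕ | IsMaxCoeffAt F n}

end Literature.NumberTheory.EllipticCurves

end
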